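import Mathlib
import Summits.ValiantsHypothesis.ValiantsHypothesis.Theorems.NewtonUnitEquationsDissociatedUniformTotalsLaw
import Summits.ValiantsHypothesis.ValiantsHypothesis.Theorems.NewtonUnitEquationsDissociatedUniformTotalsLawUnimodal
import Summits.ValiantsHypothesis.ValiantsHypothesis.Theorems.NewtonUnitEquationsDissociatedUniformTotalsLawChains
import Summits.ValiantsHypothesis.ValiantsHypothesis.Theorems.NewtonUnitEquationsDissociatedUniformTotalsLawHexagon
import Summits.ValiantsHypothesis.ValiantsHypothesis.Theorems.NewtonUnitEquationsDissociatedUniformTotalsLawHexagonCount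
import HarnessLib

/-!
# Crux `NewtonUnitEquations.DissociatedUniform` (stmt-ValiantsHypothesis-5905), `n = 3` totals law of model (Q**):
# the HODOGRAPH-CONVEX TOTALS LAW `T ≤ 12 q²`

By `…TotalsLawHexagonCount.totalVert_le_two_mul_flips`, for ALL curves `a, b, c : ℤ/q → ℝ²` the totals satisfy
`T ≤ 2 (N_a + N_b + N_c)`, where `N_c = flipsC a b c` counts the `c`-direction sign changes
`O(i,j,k)·O(i,j,k+1) ≤ 0` of the orientation tensor `O(i,j,k) = orient(Δa i, Δb j, Δc k)` of the three HODOGRAPHS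
(edge-vector curves `Δf i = f (i+1) - f i`).  For fixed `(i, j)` the map `k ↦ O(i,j,k)` is an affine functional of the point
`Δc k` (`orientT_affine₃`), so if the hodograph `Δc` is CONVEXLY ORDERED (`…TotalsLawUnimodal.ConvexlyOrdered`: every linear
functional is cyclically unimodal along the labels — the edge vectors are the vertices of a convex polygon met in cyclic order,
collinear runs allowed) then this cyclic sequence crosses any level at most twice:

* `sum_indic_cross_le_two`: a cyclically unimodal `f : ℤ/q → ℝ` has at most `2` labels `k` with `(f k - t)(f (k+1) - t) < 0`
  (at most one up-crossing — on the ascending arc or the wrap step — and at most one down-crossing);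
* `sum_indic_mul_nonpos_le`: hence at most `2 + 2·#{k : f k = t}` labels with `(f k - t)(f (k+1) - t) ≤ 0`;
* `flipsC_le` (`flipsA_le`, `flipsB_le`): `N_c ≤ 2q² + 2·Z` where `Z = zeroCount a b c = #{(i,j,k) : O(i,j,k) = 0}` is the
  number of COLLINEAR triples of edge vectors (`0` in general position), whenever `Δc` (resp. `Δa`, `Δb`) is convexly ordered;
* **`totalVert_le_of_hodographs_convexlyOrdered`**: if all three hodographs are convexly ordered then
  `T(a,b,c) ≤ 12 q² + 12 Z`, and **`totalVert_le_twelve_mul_sq_of_hodographs`**: `T ≤ 12 q²` in general position (`Z = 0`).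

This is the first kernel theorem of the `n = 3` law with a GENERAL (q-valued) third curve on a named stratum containing the
census families (regular polygons / circles, and the census parabolas `(P k, Q k²)` whose hodograph `(P, Q(2k+1))` plus one
wrap-around vector is convexly ordered); the census constant there is `2.00` (NOTES-d1g3 §3), the mixed-hexagon count itself is
`4–5 q²` (this seat's census), `12` is the bookkeeping constant.  Hodograph convexity is a smoothness condition on the
LABELLING (edge lengths may not oscillate); arbitrary labellings — the open case of `TotalsLawThree C` — are not covered, and for
them `N_a + N_b + N_c` is genuinely cubic.  VP ≠ VNP is not touched.
[folklore: a line meets the boundary of a convex polygon in at most two points, so the vertices strictly on one side form a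
cyclic interval]
-/

set_option linter.dupNamespace false -- `ValiantsHypothesis.ValiantsHypothesis` (summit = problem) in every name

open scoped BigOperators Pointwise

namespace Summit.ValiantsHypothesis.ValiantsHypothesis.Theorems.NewtonUnitEquationsDissociatedUniform

namespace TotalsLaw

open Matrix

/-! ### Level crossings of a cyclically unimodal sequence -/

section Crossings

variable {q : ℕ} [NeZero q]

/-- A sum of indicators of a property with at most one witness is at most `1`. [folklore] -/
theorem sum_indic_le_one_of_subsingleton {ι : Type*} [Fintype ι] (P : ι → Prop) (h : ∀ k₁ k₂, P k₁ → P k₂ → k₁ = k₂) :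
    ∑ k, indic (P k) ≤ 1 := by
  classical
  by_cases hex : ∃ k₀, P k₀
  · obtain ⟨k₀, hk₀⟩ := hex
    rw [Finset.sum_eq_single k₀ (fun k _ hk => indic_of_false fun hk' => hk (h k k₀ hk' hk₀)) (fun hk => absurd (Finset.mem_univ _) hk)]
    exact indic_le_one _
  · push Not at hex
    rw [Finset.sum_eq_zero fun k _ => indic_of_false (hex k)]
    exact Nat.zero_le _

/-- **At most one up-crossing.**  For `f` cyclically unimodal with witness `(n, d)`, two labels `k` with `f k < t < f (k + 1)` coincide
(a strict increase happens only on the ascending arc from `n` or at the wrap step `n - 1 → n`, and the values in between are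
monotone). [folklore] -/
theorem CycUnimodalAt.upcross_unique {f : ZMod q → ℝ} {n : ZMod q} {d : ℕ} (h : CycUnimodalAt f n d) {t : ℝ} {k₁ k₂ : ZMod q}
    (h₁ : f k₁ < t ∧ t < f (k₁ + 1)) (h₂ : f k₂ < t ∧ t < f (k₂ + 1)) : k₁ = k₂ := by
  have hd := h.1
  -- positions
  set p₁ := (k₁ - n).val with hp₁
  set p₂ := (k₂ - n).val with hp₂
  have hp₁q : p₁ < q := ZMod.val_lt _
  have hp₂q : p₂ < q := ZMod.val_lt _
  have e₁ : k₁ = n + (p₁ : ZMod q) := eq_add_val n k₁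
  have e₂ : k₂ = n + (p₂ : ZMod q) := eq_add_val n k₂
  have e₁' : k₁ + 1 = n + ((p₁ + 1 : ℕ) : ZMod q) := by rw [e₁]; push_cast; ring
  have e₂' : k₂ + 1 = n + ((p₂ + 1 : ℕ) : ZMod q) := by rw [e₂]; push_cast; ring
  -- a strict increase is not on the descending arc (unless it is the wrap step)
  have asc₁ : p₁ < d ∨ p₁ + 1 = q := by
    by_contra hc
    push Not at hc
    have := h.2.2 p₁ hc.1 (by omega)
    rw [← e₁, ← e₁'] at this
    linarith [h₁.1, h₁.2]
  have asc₂ : p₂ < d ∨ p₂ + 1 = q := by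
    by_contra hc
    push Not at hc
    have := h.2.2 p₂ hc.1 (by omega)
    rw [← e₂, ← e₂'] at this
    linarith [h₂.1, h₂.2]
  have hwrap : ∀ {p : ℕ}, p + 1 = q → (n + ((p + 1 : ℕ) : ZMod q)) = n := by
    intro p hp
    rw [hp, ZMod.natCast_self, add_zero]
  rcases asc₁ with a₁ | w₁ <;> rcases asc₂ with a₂ | w₂
  · -- both on the ascending arc
    rcases lt_trichotomy p₁ p₂ with hlt | heq | hgt
    · have := h.asc_le (show p₁ + 1 ≤ p₂ by omega) a₂.le
      rw [← e₁', ← e₂] at this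
      linarith [h₁.2, h₂.1]
    · rw [e₁, e₂, heq]
    · have := h.asc_le (show p₂ + 1 ≤ p₁ by omega) a₁.le
      rw [← e₂', ← e₁] at this
      linarith [h₂.2, h₁.1]
  · -- `k₂` is the wrap step, `k₁` ascending: `f k₁ ≥ f n = f (k₂ + 1) > t`
    have := h.asc_le (Nat.zero_le p₁) a₁.le
    rw [Nat.cast_zero, add_zero, ← e₁, ← hwrap w₂, ← e₂'] at this
    linarith [h₁.1, h₂.2]
  · have := h.asc_le (Nat.zero_le p₂) a₂.le
    rw [Nat.cast_zero, add_zero, ← e₂, ← hwrap w₁, ← e₁'] at this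
    linarith [h₂.1, h₁.2]
  · rw [e₁, e₂, show p₁ = p₂ by omega]

/-- **At most one down-crossing** (`f k > t > f (k + 1)`): symmetric, on the descending arc or the wrap step. [folklore] -/
theorem CycUnimodalAt.downcross_unique {f : ZMod q → ℝ} {n : ZMod q} {d : ℕ} (h : CycUnimodalAt f n d) {t : ℝ}
    {k₁ k₂ : ZMod q} (h₁ : t < f k₁ ∧ f (k₁ + 1) < t) (h₂ : t < f k₂ ∧ f (k₂ + 1) < t) : k₁ = k₂ := by
  have hd := h.1
  set p₁ := (k₁ - n).val with hp₁
  set p₂ := (k₂ - n).val with hp₂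
  have hp₁q : p₁ < q := ZMod.val_lt _
  have hp₂q : p₂ < q := ZMod.val_lt _
  have e₁ : k₁ = n + (p₁ : ZMod q) := eq_add_val n k₁
  have e₂ : k₂ = n + (p₂ : ZMod q) := eq_add_val n k₂
  have e₁' : k₁ + 1 = n + ((p₁ + 1 : ℕ) : ZMod q) := by rw [e₁]; push_cast; ring
  have e₂' : k₂ + 1 = n + ((p₂ + 1 : ℕ) : ZMod q) := by rw [e₂]; push_cast; ring
  -- a strict decrease is not on the ascending arc
  have dsc₁ : d ≤ p₁ := by
    by_contra hc
    have := h.2.1 p₁ (not_le.1 hc)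
    rw [← e₁, ← e₁'] at this
    linarith [h₁.1, h₁.2]
  have dsc₂ : d ≤ p₂ := by
    by_contra hc
    have := h.2.1 p₂ (not_le.1 hc)
    rw [← e₂, ← e₂'] at this
    linarith [h₂.1, h₂.2]
  have hlast : ∀ {p : ℕ}, p + 1 = q → (n + ((q - 1 : ℕ) : ZMod q)) = n + (p : ZMod q) := by
    intro p hp; rw [show q - 1 = p by omega]
  rcases Nat.lt_or_ge (p₁ + 1) q with i₁ | w₁ <;> rcases Nat.lt_or_ge (p₂ + 1) q with i₂ | w₂
  · -- both interior to the descending arc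
    rcases lt_trichotomy p₁ p₂ with hlt | heq | hgt
    · have := h.desc_le (show d ≤ p₁ + 1 by omega) (show p₁ + 1 ≤ p₂ by omega) hp₂q
      rw [← e₁', ← e₂] at this
      linarith [h₁.2, h₂.1]
    · rw [e₁, e₂, heq]
    · have := h.desc_le (show d ≤ p₂ + 1 by omega) (show p₂ + 1 ≤ p₁ by omega) hp₁q
      rw [← e₂', ← e₁] at this
      linarith [h₂.2, h₁.1]
  · -- `k₂` is the wrap step (`p₂ = q - 1`): `f k₂ ≤ f (k₁ + 1) < t`
    have := h.desc_le (show d ≤ p₁ + 1 by omega) (show p₁ + 1 ≤ q - 1 by omega) (by omega)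
    rw [← e₁', hlast (show p₂ + 1 = q by omega), ← e₂] at this
    linarith [h₁.2, h₂.1]
  · have := h.desc_le (show d ≤ p₂ + 1 by omega) (show p₂ + 1 ≤ q - 1 by omega) (by omega)
    rw [← e₂', hlast (show p₁ + 1 = q by omega), ← e₁] at this
    linarith [h₂.2, h₁.1]
  · rw [e₁, e₂, show p₁ = p₂ by omega]

/-- **A cyclically unimodal sequence crosses every level at most twice**: `#{k : (f k - t)(f (k+1) - t) < 0} ≤ 2`. [folklore] -/
theorem sum_indic_cross_le_two {f : ZMod q → ℝ} (hf : CycUnimodal f) (t : ℝ) :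
    ∑ k : ZMod q, indic ((f k - t) * (f (k + 1) - t) < 0) ≤ 2 := by
  obtain ⟨n, d, h⟩ := hf
  have hsplit : ∀ k : ZMod q, indic ((f k - t) * (f (k + 1) - t) < 0) ≤
      indic (f k < t ∧ t < f (k + 1)) + indic (t < f k ∧ f (k + 1) < t) := by
    intro k
    by_cases hk : (f k - t) * (f (k + 1) - t) < 0
    · rw [indic_of_true hk]
      rcases mul_neg_iff.1 hk with ⟨h1, h2⟩ | ⟨h1, h2⟩
      · -- down-crossing
        rw [indic_of_false fun h' => by linarith [h'.1], indic_of_true ⟨by linarith, by linarith⟩]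
      · -- up-crossing
        rw [indic_of_true ⟨by linarith, by linarith⟩]; omega
    · rw [indic_of_false hk]; exact Nat.zero_le _
  calc ∑ k : ZMod q, indic ((f k - t) * (f (k + 1) - t) < 0)
      ≤ ∑ k : ZMod q, (indic (f k < t ∧ t < f (k + 1)) + indic (t < f k ∧ f (k + 1) < t)) := Finset.sum_le_sum fun k _ => hsplit k
    _ = ∑ k : ZMod q, indic (f k < t ∧ t < f (k + 1)) + ∑ k : ZMod q, indic (t < f k ∧ f (k + 1) < t) :=
        Finset.sum_add_distrib
    _ ≤ 1 + 1 := Nat.add_le_add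
        (sum_indic_le_one_of_subsingleton _ fun _ _ h₁ h₂ => h.upcross_unique h₁ h₂)
        (sum_indic_le_one_of_subsingleton _ fun _ _ h₁ h₂ => h.downcross_unique h₁ h₂)

/-- Shift reindexing of a label sum. [folklore] -/
theorem sum_indic_succ_eq (P : ZMod q → Prop) : ∑ k : ZMod q, indic (P (k + 1)) = ∑ k : ZMod q, indic (P k) :=
  Equiv.sum_comp (Equiv.addRight 1) fun k => indic (P k)

/-- **Weak crossings**: `#{k : (f k - t)(f (k+1) - t) ≤ 0} ≤ 2 + 2·#{k : f k = t}` for `f` cyclically unimodal. [folklore] -/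
theorem sum_indic_mul_nonpos_le {f : ZMod q → ℝ} (hf : CycUnimodal f) (t : ℝ) :
    ∑ k : ZMod q, indic ((f k - t) * (f (k + 1) - t) ≤ 0) ≤ 2 + 2 * ∑ k : ZMod q, indic (f k = t) := by
  have hsplit : ∀ k : ZMod q, indic ((f k - t) * (f (k + 1) - t) ≤ 0) ≤
      indic ((f k - t) * (f (k + 1) - t) < 0) + indic (f k = t) + indic (f (k + 1) = t) := by
    intro k
    by_cases hk : (f k - t) * (f (k + 1) - t) ≤ 0
    · rw [indic_of_true hk]
      rcases hk.lt_or_eq with hlt | heq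
      · rw [indic_of_true hlt]; omega
      · rcases mul_eq_zero.1 heq with h0 | h0
        · rw [indic_of_true (sub_eq_zero.1 h0)]; omega
        · rw [indic_of_true (sub_eq_zero.1 h0 : f (k + 1) = t)]; omega
    · rw [indic_of_false hk]; exact Nat.zero_le _
  calc ∑ k : ZMod q, indic ((f k - t) * (f (k + 1) - t) ≤ 0)
      ≤ ∑ k : ZMod q, (indic ((f k - t) * (f (k + 1) - t) < 0) + indic (f k = t) + indic (f (k + 1) = t)) :=
        Finset.sum_le_sum fun k _ => hsplit k
    _ = ∑ k : ZMod q, indic ((f k - t) * (f (k + 1) - t) < 0) + ∑ k : ZMod q, indic (f k = t) +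
          ∑ k : ZMod q, indic (f (k + 1) = t) := by rw [Finset.sum_add_distrib, Finset.sum_add_distrib]
    _ ≤ 2 + ∑ k : ZMod q, indic (f k = t) + ∑ k : ZMod q, indic (f k = t) := by
        rw [sum_indic_succ_eq (fun k => f k = t)]
        exact Nat.add_le_add_right (Nat.add_le_add_right (sum_indic_cross_le_two hf t) _) _
    _ = 2 + 2 * ∑ k : ZMod q, indic (f k = t) := by ring

end Crossings

/-! ### The orientation tensor is affine in each hodograph -/

section Affine

variable {q : ℕ} (a b c : ZMod q → (Fin 2 → ℝ)) (i j k : ZMod q)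

/-- `orient(A, B, C) = ⟨rot(B - A), C⟩ + det(A, B)`: affine in the third point. [folklore] -/
theorem orientT_affine₃ :
    orientT a b c i j k = ![-(edgeVec b j - edgeVec a i) 1, (edgeVec b j - edgeVec a i) 0] ⬝ᵥ edgeVec c k -
      (-cross2 (edgeVec a i) (edgeVec b j)) := by
  simp only [orientT, orient3, cross2, dotProduct_fin_two, Matrix.cons_val_zero, Matrix.cons_val_one, Pi.sub_apply]
  ring

/-- `orient(A, B, C) = ⟨rot(C - B), A⟩ + det(B, C)`: affine in the first point. [folklore] -/
theorem orientT_affine₁ :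
    orientT a b c i j k = ![-(edgeVec c k - edgeVec b j) 1, (edgeVec c k - edgeVec b j) 0] ⬝ᵥ edgeVec a i -
      (-cross2 (edgeVec b j) (edgeVec c k)) := by
  simp only [orientT, orient3, cross2, dotProduct_fin_two, Matrix.cons_val_zero, Matrix.cons_val_one, Pi.sub_apply]
  ring

/-- `orient(A, B, C) = ⟨rot(A - C), B⟩ + det(C, A)`: affine in the second point. [folklore] -/
theorem orientT_affine₂ :
    orientT a b c i j k = ![-(edgeVec a i - edgeVec c k) 1, (edgeVec a i - edgeVec c k) 0] ⬝ᵥ edgeVec b j -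
      (-cross2 (edgeVec c k) (edgeVec a i)) := by
  simp only [orientT, orient3, cross2, dotProduct_fin_two, Matrix.cons_val_zero, Matrix.cons_val_one, Pi.sub_apply]
  ring

end Affine

/-! ### Bounding the sign changes on the hodograph-convex stratum -/

section Flips

variable {q : ℕ} [NeZero q] (a b c : ZMod q → (Fin 2 → ℝ))

/-- `Z`: the number of COLLINEAR edge-vector triples, `#{(i,j,k) : orient(Δa i, Δb j, Δc k) = 0}` (`0` in general position). -/
noncomputable def zeroCount : ℕ := ∑ i : ZMod q, ∑ j : ZMod q, ∑ k : ZMod q, indic (orientT a b c i j k = 0)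

/-- `q = |ℤ/q|` as a sum of ones. [folklore] -/
theorem sum_const_nat (m : ℕ) : ∑ _i : ZMod q, m = q * m := by
  rw [Finset.sum_const, Finset.card_univ, ZMod.card, smul_eq_mul]

/-- **`N_c ≤ 2q² + 2Z`** when the hodograph `Δc` is convexly ordered: for each `(i, j)` the cyclic sequence
`k ↦ orient(Δa i, Δb j, Δc k)` is an affine functional of `Δc k`, hence cyclically unimodal, and crosses `0` weakly at most
`2 + 2·#{zeros}` times. [folklore] -/
theorem flipsC_le (hc : ConvexlyOrdered (edgeVec c)) : flipsC a b c ≤ 2 * q ^ 2 + 2 * zeroCount a b c := by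
  have inner : ∀ i j : ZMod q, ∑ k : ZMod q, indic (flipC a b c i j k) ≤
      2 + 2 * ∑ k : ZMod q, indic (orientT a b c i j k = 0) := by
    intro i j
    set w : Fin 2 → ℝ := ![-(edgeVec b j - edgeVec a i) 1, (edgeVec b j - edgeVec a i) 0] with hw
    set t : ℝ := -cross2 (edgeVec a i) (edgeVec b j) with ht
    have hO : ∀ k, orientT a b c i j k = w ⬝ᵥ edgeVec c k - t := fun k => orientT_affine₃ a b c i j k
    have h := sum_indic_mul_nonpos_le (hc w) t
    have e1 : ∀ k : ZMod q, indic (flipC a b c i j k) = indic ((w ⬝ᵥ edgeVec c k - t) * (w ⬝ᵥ edgeVec c (k + 1) - t) ≤ 0) := by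
      intro k; unfold flipC; rw [hO k, hO (k + 1)]
    have e2 : ∀ k : ZMod q, indic (orientT a b c i j k = 0) = indic (w ⬝ᵥ edgeVec c k = t) := by
      intro k; rw [hO k, sub_eq_zero]
    simp only [e1, e2]
    exact h
  unfold flipsC zeroCount
  calc ∑ i : ZMod q, ∑ j : ZMod q, ∑ k : ZMod q, indic (flipC a b c i j k)
      ≤ ∑ i : ZMod q, ∑ j : ZMod q, (2 + 2 * ∑ k : ZMod q, indic (orientT a b c i j k = 0)) :=
        Finset.sum_le_sum fun i _ => Finset.sum_le_sum fun j _ => inner i j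
    _ = 2 * q ^ 2 + 2 * ∑ i : ZMod q, ∑ j : ZMod q, ∑ k : ZMod q, indic (orientT a b c i j k = 0) := by
        simp only [Finset.sum_add_distrib, sum_const_nat, ← Finset.mul_sum]
        ring

/-- **`N_a ≤ 2q² + 2Z`** when the hodograph `Δa` is convexly ordered. [folklore] -/
theorem flipsA_le (ha : ConvexlyOrdered (edgeVec a)) : flipsA a b c ≤ 2 * q ^ 2 + 2 * zeroCount a b c := by
  have inner : ∀ j k : ZMod q, ∑ i : ZMod q, indic (flipA a b c i j k) ≤
      2 + 2 * ∑ i : ZMod q, indic (orientT a b c i j k = 0) := by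
    intro j k
    set w : Fin 2 → ℝ := ![-(edgeVec c k - edgeVec b j) 1, (edgeVec c k - edgeVec b j) 0] with hw
    set t : ℝ := -cross2 (edgeVec b j) (edgeVec c k) with ht
    have hO : ∀ i, orientT a b c i j k = w ⬝ᵥ edgeVec a i - t := fun i => orientT_affine₁ a b c i j k
    have h := sum_indic_mul_nonpos_le (ha w) t
    have e1 : ∀ i : ZMod q, indic (flipA a b c i j k) = indic ((w ⬝ᵥ edgeVec a i - t) * (w ⬝ᵥ edgeVec a (i + 1) - t) ≤ 0) := by
      intro i; unfold flipA; rw [hO i, hO (i + 1)]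
    have e2 : ∀ i : ZMod q, indic (orientT a b c i j k = 0) = indic (w ⬝ᵥ edgeVec a i = t) := by
      intro i; rw [hO i, sub_eq_zero]
    simp only [e1, e2]
    exact h
  unfold flipsA zeroCount
  -- bring the `i`-sum inside
  rw [Finset.sum_comm]
  conv_lhs => arg 2; ext j; rw [Finset.sum_comm]
  rw [Finset.sum_comm (f := fun i j => ∑ k : ZMod q, indic (orientT a b c i j k = 0))]
  conv_rhs => arg 2; arg 2; arg 2; ext j; rw [Finset.sum_comm]
  calc ∑ j : ZMod q, ∑ k : ZMod q, ∑ i : ZMod q, indic (flipA a b c i j k)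
      ≤ ∑ j : ZMod q, ∑ k : ZMod q, (2 + 2 * ∑ i : ZMod q, indic (orientT a b c i j k = 0)) :=
        Finset.sum_le_sum fun j _ => Finset.sum_le_sum fun k _ => inner j k
    _ = 2 * q ^ 2 + 2 * ∑ j : ZMod q, ∑ k : ZMod q, ∑ i : ZMod q, indic (orientT a b c i j k = 0) := by
        simp only [Finset.sum_add_distrib, sum_const_nat, ← Finset.mul_sum]
        ring

/-- **`N_b ≤ 2q² + 2Z`** when the hodograph `Δb` is convexly ordered. [folklore] -/
theorem flipsB_le (hb : ConvexlyOrdered (edgeVec b)) : flipsB a b c ≤ 2 * q ^ 2 + 2 * zeroCount a b c := by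
  have inner : ∀ i k : ZMod q, ∑ j : ZMod q, indic (flipB a b c i j k) ≤
      2 + 2 * ∑ j : ZMod q, indic (orientT a b c i j k = 0) := by
    intro i k
    set w : Fin 2 → ℝ := ![-(edgeVec a i - edgeVec c k) 1, (edgeVec a i - edgeVec c k) 0] with hw
    set t : ℝ := -cross2 (edgeVec c k) (edgeVec a i) with ht
    have hO : ∀ j, orientT a b c i j k = w ⬝ᵥ edgeVec b j - t := fun j => orientT_affine₂ a b c i j k
    have h := sum_indic_mul_nonpos_le (hb w) t
    have e1 : ∀ j : ZMod q, indic (flipB a b c i j k) = indic ((w ⬝ᵥ edgeVec b j - t) * (w ⬝ᵥ edgeVec b (j + 1) - t) ≤ 0) := by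
      intro j; unfold flipB; rw [hO j, hO (j + 1)]
    have e2 : ∀ j : ZMod q, indic (orientT a b c i j k = 0) = indic (w ⬝ᵥ edgeVec b j = t) := by
      intro j; rw [hO j, sub_eq_zero]
    simp only [e1, e2]
    exact h
  unfold flipsB zeroCount
  conv_lhs => arg 2; ext i; rw [Finset.sum_comm]
  conv_rhs => arg 2; arg 2; arg 2; ext i; rw [Finset.sum_comm]
  calc ∑ i : ZMod q, ∑ k : ZMod q, ∑ j : ZMod q, indic (flipB a b c i j k)
      ≤ ∑ i : ZMod q, ∑ k : ZMod q, (2 + 2 * ∑ j : ZMod q, indic (orientT a b c i j k = 0)) :=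
        Finset.sum_le_sum fun i _ => Finset.sum_le_sum fun k _ => inner i k
    _ = 2 * q ^ 2 + 2 * ∑ i : ZMod q, ∑ k : ZMod q, ∑ j : ZMod q, indic (orientT a b c i j k = 0) := by
        simp only [Finset.sum_add_distrib, sum_const_nat, ← Finset.mul_sum]
        ring

/-- **THE HODOGRAPH-CONVEX TOTALS LAW.**  If the hodographs `Δa, Δb, Δc` of the three curves are convexly ordered then
`T(a,b,c) ≤ 12 q² + 12 Z`, `Z = #`collinear edge-vector triples. [folklore] -/
theorem totalVert_le_of_hodographs_convexlyOrdered (ha : ConvexlyOrdered (edgeVec a)) (hb : ConvexlyOrdered (edgeVec b))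
    (hc : ConvexlyOrdered (edgeVec c)) : totalVert a b c ≤ 12 * q ^ 2 + 12 * zeroCount a b c := by
  have h := totalVert_le_two_mul_flips a b c
  have hA := flipsA_le a b c ha
  have hB := flipsB_le a b c hb
  have hC := flipsC_le a b c hc
  omega

/-- **General position: `T ≤ 12 q²`.**  If moreover no edge vector of `c` is collinear with an edge vector of `a` and one of `b`
(`orient(Δa i, Δb j, Δc k) ≠ 0` for all `i, j, k`), then `T(a,b,c) ≤ 12 q²` — the `n = 3` totals law with constant `12` on the
hodograph-convex stratum, for a GENERAL third curve. [folklore] -/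
theorem totalVert_le_twelve_mul_sq_of_hodographs (ha : ConvexlyOrdered (edgeVec a)) (hb : ConvexlyOrdered (edgeVec b))
    (hc : ConvexlyOrdered (edgeVec c)) (hgp : ∀ i j k : ZMod q, orientT a b c i j k ≠ 0) :
    totalVert a b c ≤ 12 * q ^ 2 := by
  have hZ : zeroCount a b c = 0 := by
    unfold zeroCount
    exact Finset.sum_eq_zero fun i _ => Finset.sum_eq_zero fun j _ => Finset.sum_eq_zero fun k _ => indic_of_false (hgp i j k)
  have h := totalVert_le_of_hodographs_convexlyOrdered a b c ha hb hc
  rw [hZ, mul_zero, add_zero] at h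
  exact h

end Flips

end TotalsLaw

end Summit.ValiantsHypothesis.ValiantsHypothesis.Theorems.NewtonUnitEquationsDissociatedUniform
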